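import Literature.Analysis.FluidPDE.SolenoidalCZeroSpace
import Literature.Analysis.FluidPDE.SolenoidalSupDensity
import HarnessLib

/-!
# Smooth compactly supported solenoidal fields inside `C₀,σ`: a dense submodule and small
# solenoidal truncation data

Analysis/FluidPDE support file (everything proved; no definitions, no named facts).  In the
Banach space `F ≅ C₀,σ` (the closed submodule of `ℓ^∞(E; E)` of continuous, weakly
divergence-free fields vanishing at infinity, `SolenoidalCZeroSpace.lean`), dimension three:

* `exists_dense_submodule_testFields` — the elements whose underlying field is smooth,
  compactly supported and divergence free form a **dense submodule** `D` (sup-norm density of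
  `C^∞_{c,σ}` in `C₀,σ`, `exists_divFree_test_sup_approx`; Galdi 2011, Thm. III.4.3);
* `exists_small_solenoidal_truncation_datum` — for a smooth divergence-free field `U` with the
  critical decay `‖y‖‖U y‖ ≤ C₀` (a Type-I self-similar profile, Leray's rate) and every
  `ε > 0` there is `e ∈ F` of norm `< ε` with `U + e` smooth, compactly supported and divergence
  free: `e = Ψ_L(U) − U` for the solenoidal truncation `Ψ_L` at a large radius `L`
  (`exists_norm_solenoidalTruncation_sub_le_div`: sup error `≤ κ C₀/L`).

## Mathlib / tree search

Tree: `exists_divFree_test_sup_approx`, `exists_norm_solenoidalTruncation_sub_le_div`,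
`solenoidalTruncation`, `contDiff_/hasCompactSupport_/isDivFree_solenoidalTruncation`,
`VectorCalculus.IsDivFree.isWeaklyDivFree_holds`, `VectorCalculus.IsDivFree.const_smul`,
`norm_le_of_forall_le_submodule`, `tendsto_cocompact_nhds_zero_iff_norm`. Mathlib:
`Metric.dense_iff`, `HasCompactSupport.is_zero_at_infty`,
`Continuous.bounded_above_of_compact_support`, `fderiv_add`.

## References

* G. P. Galdi, *An Introduction to the Mathematical Theory of the Navier–Stokes Equations*,
  2nd ed. 2011, Thm. III.4.3. [Galdi2011]
-/

noncomputable section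

open MeasureTheory Set Function Filter Metric
open _root_.Topology

namespace Literature.Analysis.FluidPDE

variable {E : Type*} [NormedAddCommGroup E] [InnerProductSpace ℝ E] [FiniteDimensional ℝ E]
  [MeasurableSpace E] [BorelSpace E]

omit [FiniteDimensional ℝ E] [MeasurableSpace E] [BorelSpace E] in
/-- Sums of smooth divergence-free fields are divergence free (linearity of `D` and of the
trace). [folklore] -/
theorem isDivFree_add_of_contDiff {f g : E → E} (hf : ContDiff ℝ 1 f) (hg : ContDiff ℝ 1 g)
    (hfd : VectorCalculus.IsDivFree f) (hgd : VectorCalculus.IsDivFree g) :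
    VectorCalculus.IsDivFree (f + g) := by
  intro x
  have h1 := hfd x
  have h2 := hgd x
  simp only [VectorCalculus.divergence] at h1 h2 ⊢
  rw [fderiv_add ((hf.differentiable one_ne_zero).differentiableAt)
    ((hg.differentiable one_ne_zero).differentiableAt)]
  simp [map_add, h1, h2]

/-- **The smooth compactly supported divergence-free elements of `C₀,σ` form a dense
submodule** (dimension three; sup-norm density of `C^∞_{c,σ}`, Galdi 2011, Thm. III.4.3 in
`C₀`). [cite: Galdi2011, Thm. III.4.3] -/
theorem exists_dense_submodule_testFields (hE : Module.finrank ℝ E = 3)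
    (F : Submodule ℝ (lp (fun _ : E => E) ⊤))
    (hF : ∀ f : lp (fun _ : E => E) ⊤, f ∈ F ↔
      (Continuous ⇑f ∧ Tendsto ⇑f (cocompact E) (𝓝 0) ∧ IsWeaklyDivFree ⇑f)) :
    ∃ D : Submodule ℝ F, Dense (D : Set F) ∧
      ∀ d ∈ D, ContDiff ℝ (⊤ : ℕ∞) (⇑d.1 : E → E) ∧ HasCompactSupport (⇑d.1 : E → E) ∧
        VectorCalculus.IsDivFree (⇑d.1 : E → E) := by
  let D : Submodule ℝ F :=
    { carrier := {d | ContDiff ℝ (⊤ : ℕ∞) (⇑d.1 : E → E) ∧ HasCompactSupport (⇑d.1 : E → E) ∧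
        VectorCalculus.IsDivFree (⇑d.1 : E → E)}
      add_mem' := by
        rintro f g ⟨hfs, hfc, hfd⟩ ⟨hgs, hgc, hgd⟩
        have e : (⇑(f + g).1 : E → E) = ⇑f.1 + ⇑g.1 := by funext x; simp
        simp only [mem_setOf_eq, e]
        exact ⟨hfs.add hgs, hfc.add hgc,
          isDivFree_add_of_contDiff (hfs.of_le (by exact_mod_cast le_top))
            (hgs.of_le (by exact_mod_cast le_top)) hfd hgd⟩
      zero_mem' := by
        have e : (⇑(0 : F).1 : E → E) = 0 := by funext x; simp
        simp only [mem_setOf_eq, e]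
        exact ⟨contDiff_const, HasCompactSupport.zero, fun x => by simp [VectorCalculus.divergence]⟩
      smul_mem' := by
        rintro r f ⟨hfs, hfc, hfd⟩
        have e : (⇑(r • f).1 : E → E) = r • ⇑f.1 := by funext x; simp
        simp only [mem_setOf_eq, e]
        exact ⟨hfs.const_smul r, hfc.mono (Function.support_const_smul_subset r _),
          VectorCalculus.IsDivFree.const_smul (hfs.differentiable (by simp)) hfd r⟩ }
  refine ⟨D, ?_, fun d hd => hd⟩
  have hPf : ∀ f : F, Continuous ⇑f.1 ∧ Tendsto ⇑f.1 (cocompact E) (𝓝 0) ∧ IsWeaklyDivFree ⇑f.1 :=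
    fun f => (hF f.1).1 f.2
  refine Metric.dense_iff.2 fun e r hr => ?_
  obtain ⟨W, hWs, hWc, hWd, hWe⟩ :=
    exists_divFree_test_sup_approx hE (hPf e).1 (hPf e).2.1 (hPf e).2.2 (half_pos hr)
  obtain ⟨C, hC⟩ := hWs.continuous.bounded_above_of_compact_support hWc
  have hmem : Memℓp W ⊤ := memℓp_infty ⟨C, by rintro _ ⟨x, rfl⟩; exact hC x⟩
  have hWF : (⟨W, hmem⟩ : lp (fun _ : E => E) ⊤) ∈ F :=
    (hF _).2 ⟨hWs.continuous, hWc.is_zero_at_infty,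
      VectorCalculus.IsDivFree.isWeaklyDivFree_holds hWd (hWs.of_le (by exact_mod_cast le_top))⟩
  set d : F := ⟨⟨W, hmem⟩, hWF⟩ with hd
  have hdD : d ∈ (D : Set F) := ⟨hWs, hWc, hWd⟩
  refine ⟨d, ⟨?_, hdD⟩⟩
  rw [mem_ball, dist_eq_norm]
  refine lt_of_le_of_lt (FunctionSpaces.norm_le_of_forall_le_submodule F _ (half_pos hr).le
    fun x => ?_) (half_lt_self hr)
  have h := hWe x
  have e' : ((d - e).1 : lp (fun _ : E => E) ⊤) x = W x - e.1 x := by simp [hd]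
  rw [e']
  exact h

/-- **Small solenoidal truncation data for a profile with critical decay** (dimension three).
For a smooth divergence-free field `U` with `‖y‖‖U y‖ ≤ C₀` and `ε > 0`, there is `e` in
`F ≅ C₀,σ` with `‖e‖ < ε` such that `U + e` is smooth, compactly supported and divergence free:
`e = Ψ_L(U) − U` with `L > κ C₀/ε`, `Ψ_L` the solenoidal truncation (Galdi 2011, §III.4; sup
error `κ C₀/L`, `exists_norm_solenoidalTruncation_sub_le_div`). [cite: Galdi2011, §III.4 (solenoidal truncation)] -/
theorem exists_small_solenoidal_truncation_datum (hE : Module.finrank ℝ E = 3)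
    (F : Submodule ℝ (lp (fun _ : E => E) ⊤))
    (hF : ∀ f : lp (fun _ : E => E) ⊤, f ∈ F ↔
      (Continuous ⇑f ∧ Tendsto ⇑f (cocompact E) (𝓝 0) ∧ IsWeaklyDivFree ⇑f))
    {U : E → E} {C₀ : ℝ} (hU : ContDiff ℝ (⊤ : ℕ∞) U) (hdiv : VectorCalculus.IsDivFree U)
    (hdec : ∀ y, ‖y‖ * ‖U y‖ ≤ C₀) {ε : ℝ} (hε : 0 < ε) :
    ∃ e : F, ‖e‖ < ε ∧ ContDiff ℝ (⊤ : ℕ∞) (U + ⇑e.1) ∧ HasCompactSupport (U + ⇑e.1) ∧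
      VectorCalculus.IsDivFree (U + ⇑e.1) := by
  obtain ⟨κ, hκ, hκU⟩ := exists_norm_solenoidalTruncation_sub_le_div (E := E)
  have hC₀ : 0 ≤ C₀ := by simpa using hdec 0
  set L : ℝ := κ * C₀ / ε + 1 with hL
  have hL0 : 0 < L := by positivity
  have hLε : κ * C₀ / L < ε := by
    rw [div_lt_iff₀ hL0, hL, mul_add, mul_one, mul_div_cancel₀ _ hε.ne']
    linarith
  set Ψ : E → E := solenoidalTruncation U L with hΨ
  have hΨs : ContDiff ℝ (⊤ : ℕ∞) Ψ := contDiff_solenoidalTruncation hU L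
  have hΨc : HasCompactSupport Ψ := hasCompactSupport_solenoidalTruncation hL0
  have hΨd : VectorCalculus.IsDivFree Ψ :=
    isDivFree_solenoidalTruncation hE (hU.of_le (by exact_mod_cast le_top)) hdiv L
  have hbd : ∀ x, ‖Ψ x - U x‖ ≤ κ * C₀ / L := fun x => hκU U C₀ L hdec hL0 x
  -- the truncation error `Ψ - U` lies in the class
  have hcont : Continuous (Ψ - U) := hΨs.continuous.sub hU.continuous
  have hU0 : Tendsto U (cocompact E) (𝓝 0) := by
    rw [tendsto_cocompact_nhds_zero_iff_norm]
    intro η hη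
    refine ⟨C₀ / η + 1, fun y hy => ?_⟩
    have hy0 : 0 < ‖y‖ := lt_of_lt_of_le (by positivity) hy
    have h1 : ‖U y‖ ≤ C₀ / ‖y‖ := by
      rw [le_div_iff₀ hy0, mul_comm]; exact hdec y
    refine h1.trans ?_
    rw [div_le_iff₀ hy0]
    have h2 : C₀ / η < ‖y‖ := lt_of_lt_of_le (by linarith) hy
    rw [div_lt_iff₀ hη] at h2
    linarith
  have hzero : Tendsto (Ψ - U) (cocompact E) (𝓝 0) := by
    have h := hΨc.is_zero_at_infty.sub hU0
    rw [sub_zero] at h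
    exact h
  have hsd : VectorCalculus.IsDivFree (Ψ - U) := by
    have h := isDivFree_add_of_contDiff (hΨs.of_le (by exact_mod_cast le_top))
      ((hU.of_le (by exact_mod_cast le_top)).neg) hΨd
      (by simpa using VectorCalculus.IsDivFree.const_smul (hU.differentiable (by simp)) hdiv (-1))
    have e2 : Ψ - U = Ψ + fun x => -U x := by
      funext x
      simp [sub_eq_add_neg]
    rw [e2]
    exact h
  have hwdf : IsWeaklyDivFree (Ψ - U) :=
    VectorCalculus.IsDivFree.isWeaklyDivFree_holds hsd
      ((hΨs.sub hU).of_le (by exact_mod_cast le_top))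
  have hmem : Memℓp (Ψ - U) ⊤ := memℓp_infty ⟨κ * C₀ / L, by rintro _ ⟨x, rfl⟩; exact hbd x⟩
  have heF : (⟨Ψ - U, hmem⟩ : lp (fun _ : E => E) ⊤) ∈ F := (hF _).2 ⟨hcont, hzero, hwdf⟩
  set e : F := ⟨⟨Ψ - U, hmem⟩, heF⟩ with he
  have hsum : U + ⇑e.1 = Ψ := by
    funext x
    simp [he]
  refine ⟨e, ?_, by rw [hsum]; exact hΨs, by rw [hsum]; exact hΨc, by rw [hsum]; exact hΨd⟩
  refine lt_of_le_of_lt (FunctionSpaces.norm_le_of_forall_le_submodule F e (by positivity) fun x => ?_) hLε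
  exact hbd x

end Literature.Analysis.FluidPDE

end
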